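import Summits.ValiantsHypothesis.ValiantsHypothesis.Theorems.GrenetZeonDualUnipotentThreeHalvesLongMassMonomialLedger
import Summits.ValiantsHypothesis.ValiantsHypothesis.Theorems.GrenetZeonDualUnipotentThreeHalvesLongMassAcyclic

/-!
# ECHELON LIFT — SCOPE OF THE ℕ-CHAMBER STATEMENTS (val-idea-28 g9, lens «degeneration – orbit-closure»;
# crux `GrenetZeon.DualUnipotentThreeHalves` = stmt-ValiantsHypothesis-24318; research statement (c) `SlowCore.LongMassSlowLawInv`)

Status.  VP ≠ VNP NOT proved.  (c) / 24318 / S3 / R2ᵖ OPEN.  Instrument-side ERRATUM on the lineage's own `EchelonLift.lean` rev 4 (no law asserted).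

§1 SCOPE LEMMA.  `EchelonLift.GhostDegeneration N N₀ a w` is typed with `w : Fin n × Fin n → ℕ`.  Since every monomial `x_c` of `N` at position
`(i,j)` then has `0 ≤ w c ≤ a j − a i`, the support of `N` lies in the `a`-upper region: `N i j ≠ 0 → a i ≤ a j` (`le_of_ghostDegeneration`), and
strictly `a i < a j` as soon as the weight-`0` variable does not occur in `N₀ i j` (`lt_of_ghostDegeneration`).  Hence (`relCert_of_ghostDegeneration`)
an affine pencil admitting an ℕ-chamber ghost degeneration whose initial pencil avoids weight `0` is ALREADY certified by row r7
(✓ `TriangularRow.relCert_of_gradedSupport`): `RelCert n m N (3·(⌊√n⌋·m))`.  And (`ghostDegeneration_trivial_of_irreducibleInv`) on an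
`IrreducibleInv` pencil an ℕ-chamber ghost degeneration is TRIVIAL: `a` is constant on `Fin m`, `N = N₀`, and every occurring variable has weight `0`
(so, `w` being injective, at most one variable occurs).  READING: FL2ᵃ/FL3ᵃ of rev 4 are correct kernel theorems, but as typed (ℕ-weights) their
hypothesis class sits inside the r2/r7-cheap (triangularisable) locus; the census's irreducible species need ℤ-CHAMBERS (pivots at positions of
negative `a`-weight, as in `comp-g7/echelon_lift.py`), which the kernel statements do not yet cover.  §2 (this file, typed + the transfer device):
UNROLLING `N ↦ S_L ⊗ N` (block-superdiagonal copies) preserves every whole-pencil ledger for `L ≥ n` and turns a ℤ-chamber of `N` into an ℕ-chamber of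
the unrolled pencil (`ledger_unroll_iff`, `relCert_unroll_iff`, `suppWindow_unroll_iff`, `ghostDegeneration_unroll`).  §3: the ℤ-chamber
statements `GhostDegenerationZ` / `GapPositiveZ` / ★ `LiftableWindowFormulaZ` (FL3ᶻ) and ✓ `liftableWindowFormulaZ_of_aff :
LiftableWindowFormulaAff → LiftableWindowFormulaZ` — so rev 4's kernel theorem `EchelonLift.liftableWindowFormulaAff` (statement = the byte-identical
twin `LiftableWindowFormulaAff` of §0; the Cruxes module is not an importable build target, hence the twin) yields the exact price formula along
EVERY ℤ-chamber ghost degeneration of a homogeneous affine pencil, which is the scope the census's irreducible species actually use.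
MATHEMATICAL STATUS of §1: folklore (the limit `lim_{t→0} λ(t)·N` under a one-parameter subgroup exists iff `N` lies in the parabolic `P(λ)`;
here `P(λ)` = the `a`-upper block-triangular pencils); its value is the ERRATUM on the typed scope of instrument #17, not new mathematics.
ERRATUM (for crit-7 V72 (3) / LIST row «instruments»): «kernel-exact for affine pencils» should read «kernel-exact for affine pencils admitting an
ℕ-chamber, i.e. on the a-upper (triangularisable-by-blocks) locus; for irreducible species via §3 (FL3ᶻ ⇐ FL3ᵃ by unrolling, this file)».
Nothing here is an `IrreducibleInv` constituent of (c) or progress on (c); 0 distance claimed.  No instances, no notation, no sorry.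
-/

set_option linter.dupNamespace false
set_option autoImplicit false

noncomputable section

namespace Summit.ValiantsHypothesis.ValiantsHypothesis.Cruxes.DualUnipotentThreeHalves.EchelonLiftScope

open MvPolynomial Matrix
open scoped BigOperators
open Summit.ValiantsHypothesis.ValiantsHypothesis.Cruxes.TwoDimCoefficients.DimTwoCases (AffMat IsAffine)
open Summit.ValiantsHypothesis.ValiantsHypothesis.Theorems.GrenetZeon.SlowCore (Ledger RelCert IrreducibleInv)
open Summit.ValiantsHypothesis.ValiantsHypothesis.Theorems.GrenetZeon.MonomialLedger (SuppWindow coordSpan)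
open Summit.ValiantsHypothesis.ValiantsHypothesis.Theorems.GrenetZeon.TriangularRow (relCert_of_gradedSupport)

variable {n m : ℕ}

/-! ## §0  Verbatim twins of the rev-4 definitions of `Cruxes/DualUnipotentThreeHalves/EchelonLift.lean` @8b68e45d8cf3 (l.72–111, 908–914)
(the Cruxes module is not an importable build target on the farm; the bodies below are byte-identical to rev 4's, so anyone importing both files
checks `example : EchelonLift.GhostDegeneration N N₀ a w ↔ EchelonLiftScope.GhostDegeneration N N₀ a w := Iff.rfl` etc.). -/

/-- twin of `EchelonLift.delta`. -/
def delta (e : Fin n × Fin n) : Fin n × Fin n → ℂ := Pi.single e 1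

/-- twin of `EchelonLift.GapPositive`. -/
def GapPositive (w : Fin n × Fin n → ℕ) (T : Finset (Fin n × Fin n))
    (C : (Fin n × Fin n) → (Fin n × Fin n) → ℂ) : Prop :=
  ∀ e e', C e e' ≠ 0 → e ∈ T ∧ e' ∉ T ∧ w e < w e'

/-- twin of `EchelonLift.liftVec`. -/
def liftVec (C : (Fin n × Fin n) → (Fin n × Fin n) → ℂ) (e : Fin n × Fin n) : Fin n × Fin n → ℂ :=
  delta e + ∑ e' : Fin n × Fin n, C e e' • delta e'

/-- twin of `EchelonLift.liftSpan`. -/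
def liftSpan (T : Finset (Fin n × Fin n)) (C : (Fin n × Fin n) → (Fin n × Fin n) → ℂ) :
    Submodule ℂ (Fin n × Fin n → ℂ) :=
  Submodule.span ℂ (Set.range fun e : T => liftVec C (e : Fin n × Fin n))

/-- twin of `EchelonLift.GhostDegeneration` (ℕ-weights, as typed in rev 4). -/
def GhostDegeneration (N N₀ : AffMat n m) (a : Fin m → ℤ) (w : Fin n × Fin n → ℕ) : Prop :=
  (∀ i j, MvPolynomial.constantCoeff (N i j) = 0 ∧ MvPolynomial.constantCoeff (N₀ i j) = 0) ∧
  (∀ i j, ∀ d ∈ (N₀ i j).support, ∀ c ∈ d.support, ((w c : ℕ) : ℤ) = a j - a i) ∧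
  (∀ i j, ∀ d ∈ ((N - N₀) i j).support, ∀ c ∈ d.support, ((w c : ℕ) : ℤ) < a j - a i)

/-- twin of `EchelonLift.LiftableWindowFormulaAff` (★ FL3ᵃ, a kernel THEOREM in rev 4: `EchelonLift.liftableWindowFormulaAff`). -/
def LiftableWindowFormulaAff : Prop :=
  ∀ (n m : ℕ) (N N₀ : AffMat n m) (a : Fin m → ℤ) (w : Fin n × Fin n → ℕ), Function.Injective w → IsAffine N →
    GhostDegeneration N N₀ a w → ∀ P : ℕ,
    (RelCert n m N P ↔
      ∃ (k : ℕ) (T : Finset (Fin n × Fin n)) (C : (Fin n × Fin n) → (Fin n × Fin n) → ℂ),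
        GapPositive w T C ∧ SuppWindow N₀ T k ∧ Ledger n m N (fun _ => True) (liftSpan T C) k ∧ n * k + (n * n - T.card) ≤ P)

/-! ## §1  Scope of ℕ-chamber ghost degenerations -/

/-- A nonzero polynomial with vanishing constant coefficient has a monomial with a variable in it. [folklore] -/
theorem exists_support_of_ne_zero {σ : Type*} (p : MvPolynomial σ ℂ) (hp : p ≠ 0) (h0 : constantCoeff p = 0) :
    ∃ d ∈ p.support, ∃ c, c ∈ d.support := by
  obtain ⟨d, hd⟩ := MvPolynomial.ne_zero_iff.mp hp
  have hd0 : d ≠ 0 := by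
    rintro rfl
    apply hd
    have : constantCoeff p = coeff 0 p := by rw [MvPolynomial.constantCoeff_eq]
    rw [← this, h0]
  obtain ⟨c, hc⟩ := Finsupp.support_nonempty_iff.mpr hd0
  exact ⟨d, by rwa [MvPolynomial.mem_support_iff], c, hc⟩

/-- **§1.1 (weak form).**  Under an ℕ-chamber ghost degeneration the support of `N` lies in the `a`-upper region. [this file] -/
theorem le_of_ghostDegeneration (N N₀ : AffMat n m) (a : Fin m → ℤ) (w : Fin n × Fin n → ℕ)
    (hG : GhostDegeneration N N₀ a w) (i j : Fin m) (hne : N i j ≠ 0) : a i ≤ a j := by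
  obtain ⟨h0, hmatch, hghost⟩ := hG
  obtain ⟨d, hd, c, hc⟩ := exists_support_of_ne_zero (N i j) hne (h0 i j).1
  have hwc : (0 : ℤ) ≤ ((w c : ℕ) : ℤ) := by exact_mod_cast Nat.zero_le _
  by_cases hN0 : coeff d (N₀ i j) = 0
  · have hsub : coeff d ((N - N₀) i j) ≠ 0 := by
      rw [Matrix.sub_apply, MvPolynomial.coeff_sub, hN0, sub_zero]
      exact (MvPolynomial.mem_support_iff.mp hd)
    have hlt := hghost i j d (MvPolynomial.mem_support_iff.mpr hsub) c hc
    omega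
  · have heq := hmatch i j d (MvPolynomial.mem_support_iff.mpr hN0) c hc
    omega

/-- **§1.1 SCOPE LEMMA.**  If moreover the weight-`0` variable does not occur in `N₀ i j`, then `a i < a j`. [this file] -/
theorem lt_of_ghostDegeneration (N N₀ : AffMat n m) (a : Fin m → ℤ) (w : Fin n × Fin n → ℕ)
    (hG : GhostDegeneration N N₀ a w) (i j : Fin m)
    (hpos : ∀ d ∈ (N₀ i j).support, ∀ c ∈ d.support, 0 < w c) (hne : N i j ≠ 0) : a i < a j := by
  obtain ⟨h0, hmatch, hghost⟩ := hG
  obtain ⟨d, hd, c, hc⟩ := exists_support_of_ne_zero (N i j) hne (h0 i j).1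
  have hwc : (0 : ℤ) ≤ ((w c : ℕ) : ℤ) := by exact_mod_cast Nat.zero_le _
  by_cases hN0 : coeff d (N₀ i j) = 0
  · have hsub : coeff d ((N - N₀) i j) ≠ 0 := by
      rw [Matrix.sub_apply, MvPolynomial.coeff_sub, hN0, sub_zero]
      exact (MvPolynomial.mem_support_iff.mp hd)
    have hlt := hghost i j d (MvPolynomial.mem_support_iff.mpr hsub) c hc
    omega
  · have hdm : d ∈ (N₀ i j).support := MvPolynomial.mem_support_iff.mpr hN0
    have heq := hmatch i j d hdm c hc
    have hp : (0 : ℤ) < ((w c : ℕ) : ℤ) := by exact_mod_cast hpos d hdm c hc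
    omega

/-- **§1.2  ℕ-CHAMBER GHOST DEGENERATIONS SEE ONLY THE r7-CHEAP LOCUS.**  An affine pencil with an ℕ-chamber ghost degeneration whose initial
pencil avoids the weight-`0` variable has `a`-graded (acyclic) support, hence `RelCert n m N (3·(⌊√n⌋·m))` by ✓ `relCert_of_gradedSupport`
(row r7, by name).  So the hypothesis class of FL2ᵃ/FL3ᵃ (rev 4) lies inside the locus where (c)'s bound already holds with `c = 3`. [this file] -/
theorem relCert_of_ghostDegeneration (N N₀ : AffMat n m) (hN : IsAffine N) (a : Fin m → ℤ) (w : Fin n × Fin n → ℕ)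
    (hG : GhostDegeneration N N₀ a w) (hpos : ∀ i j, ∀ d ∈ (N₀ i j).support, ∀ c ∈ d.support, 0 < w c) :
    RelCert n m N (3 * (Nat.sqrt n * m)) := by
  classical
  set S : ℤ := ∑ k, |a k| with hS
  have hnn : ∀ i, 0 ≤ a i + S := fun i => by
    have h1 : |a i| ≤ S :=
      Finset.single_le_sum (f := fun k => |a k|) (fun k _ => abs_nonneg (a k)) (Finset.mem_univ i)
    have h2 := neg_abs_le (a i)
    omega
  refine relCert_of_gradedSupport N hN (fun i => (a i + S).toNat) (fun i j hne => ?_)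
  have hlt := lt_of_ghostDegeneration N N₀ a w hG i j (hpos i j) hne
  have hi := hnn i
  have hj := hnn j
  exact (Int.toNat_lt_toNat (by omega)).mpr (by omega)

/-! ### §1.3  On `IrreducibleInv` pencils an ℕ-chamber ghost degeneration is trivial -/

/-- The `a`-sublevel coordinate subspace `{v : v i = 0 whenever θ < a i}`. -/
def subLevel (a : Fin m → ℤ) (θ : ℤ) : Submodule ℂ (Fin m → ℂ) where
  carrier := {v | ∀ i, θ < a i → v i = 0}
  add_mem' := by
    intro u v hu hv i hi
    simp [hu i hi, hv i hi]
  zero_mem' := by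
    intro i _
    rfl
  smul_mem' := by
    intro r v hv i hi
    simp [hv i hi]

theorem mem_subLevel_iff (a : Fin m → ℤ) (θ : ℤ) (v : Fin m → ℂ) : v ∈ subLevel a θ ↔ ∀ i, θ < a i → v i = 0 := Iff.rfl

/-- The sublevel subspaces are invariant under every value of a pencil with `a`-upper support. [this file] -/
theorem mulVec_mem_subLevel (N N₀ : AffMat n m) (a : Fin m → ℤ) (w : Fin n × Fin n → ℕ)
    (hG : GhostDegeneration N N₀ a w) (θ : ℤ) (x : Fin n × Fin n → ℂ) (v : Fin m → ℂ) (hv : v ∈ subLevel a θ) :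
    (N.map (MvPolynomial.eval x)).mulVec v ∈ subLevel a θ := by
  rw [mem_subLevel_iff] at hv ⊢
  intro i hi
  rw [Matrix.mulVec, dotProduct]
  apply Finset.sum_eq_zero
  intro j _
  by_cases hj : θ < a j
  · rw [hv j hj, mul_zero]
  · have hNij : N i j = 0 := by
      by_contra hne
      have := le_of_ghostDegeneration N N₀ a w hG i j hne
      omega
    rw [Matrix.map_apply, hNij, map_zero, zero_mul]

/-- **§1.3a**  `IrreducibleInv` + ℕ-chamber ghost degeneration ⇒ the cocharacter `a` is constant. [this file] -/
theorem const_of_irreducibleInv (N N₀ : AffMat n m) (a : Fin m → ℤ) (w : Fin n × Fin n → ℕ)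
    (hG : GhostDegeneration N N₀ a w) (hirr : IrreducibleInv N) : ∀ i j : Fin m, a i = a j := by
  classical
  intro i j
  -- the minimum level `θ`
  obtain ⟨i₀, -, hmin⟩ := Finset.exists_min_image Finset.univ a ⟨i, Finset.mem_univ i⟩
  have hinv : ∀ x : Fin n × Fin n → ℂ, ∀ v ∈ subLevel a (a i₀), (N.map (MvPolynomial.eval x)).mulVec v ∈ subLevel a (a i₀) :=
    fun x v hv => mulVec_mem_subLevel N N₀ a w hG (a i₀) x v hv
  rcases hirr (subLevel a (a i₀)) hinv with hbot | htop
  · -- `Pi.single i₀ 1` lies in the sublevel space: contradiction with `= ⊥`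
    have hmem : (Pi.single i₀ (1 : ℂ) : Fin m → ℂ) ∈ subLevel a (a i₀) := by
      rw [mem_subLevel_iff]
      intro k hk
      have hk' : k ≠ i₀ := by rintro rfl; exact lt_irrefl _ hk
      simp [hk']
    rw [hbot, Submodule.mem_bot] at hmem
    have := congr_fun hmem i₀
    simp at this
  · have hall : ∀ k : Fin m, a k ≤ a i₀ := by
      intro k
      have hmem : (Pi.single k (1 : ℂ) : Fin m → ℂ) ∈ subLevel a (a i₀) := by rw [htop]; exact Submodule.mem_top
      rw [mem_subLevel_iff] at hmem
      by_contra hlt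
      have := hmem k (by omega)
      simp at this
    have hi := hall i
    have hj := hall j
    have hi' := hmin i (Finset.mem_univ i)
    have hj' := hmin j (Finset.mem_univ j)
    omega

/-- **§1.3b  TRIVIALITY.**  On an `IrreducibleInv` pencil, an ℕ-chamber ghost degeneration has NO ghosts (`N = N₀`) and every occurring variable
has weight `0`; `w` being injective in FL2ᵃ/FL3ᵃ, at most one variable occurs.  So rev 4's kernel price formula is vacuous on the census's
irreducible species beyond `μ ≤ 1`; they need ℤ-chambers (§2). [this file] -/
theorem ghostDegeneration_trivial_of_irreducibleInv (N N₀ : AffMat n m) (a : Fin m → ℤ) (w : Fin n × Fin n → ℕ)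
    (hG : GhostDegeneration N N₀ a w) (hirr : IrreducibleInv N) :
    N = N₀ ∧ ∀ i j, ∀ d ∈ (N i j).support, ∀ c ∈ d.support, w c = 0 := by
  have hconst := const_of_irreducibleInv N N₀ a w hG hirr
  obtain ⟨h0, hmatch, hghost⟩ := hG
  have hNN : N = N₀ := by
    funext i j
    by_contra hne
    have hne' : (N - N₀) i j ≠ 0 := by rwa [Matrix.sub_apply, sub_ne_zero]
    have hc0 : constantCoeff ((N - N₀) i j) = 0 := by
      rw [Matrix.sub_apply, map_sub, (h0 i j).1, (h0 i j).2, sub_zero]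
    obtain ⟨d, hd, c, hc⟩ := exists_support_of_ne_zero ((N - N₀) i j) hne' hc0
    have hlt := hghost i j d hd c hc
    have hwc : (0 : ℤ) ≤ ((w c : ℕ) : ℤ) := by exact_mod_cast Nat.zero_le _
    have := hconst i j
    omega
  refine ⟨hNN, fun i j d hd c hc => ?_⟩
  rw [hNN] at hd
  have heq := hmatch i j d hd c hc
  have := hconst i j
  omega


/-! ## §2  UNROLLING `N ↦ S_L ⊗ N` (block-superdiagonal copies): whole-pencil ledgers, prices and support windows are preserved for `L ≥ n`, `L > 0`

The device that converts a ℤ-chamber of `N` into an ℕ-chamber of the unrolled pencil (§3): the unrolled pencil is block strictly upper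
triangular, so the cocharacter `(l, i) ↦ l·A + a i` has only positive differences on its support once `A` exceeds every `|w c|`. -/

section Unroll
open scoped Kronecker

variable {R : Type*}

/-- The SHIFT matrix on `Fin L`: entry `1` at `(l, l+1)`, `0` elsewhere. -/
def shiftMat (L : ℕ) (R : Type*) [Zero R] [One R] : Matrix (Fin L) (Fin L) R :=
  Matrix.of fun l l' => if l'.val = l.val + 1 then 1 else 0

/-- UNROLLED matrix `S_L ⊗ N`, indices flattened by `finProdFinEquiv : Fin L × Fin m ≃ Fin (L·m)`: the block `(l, l+1)` is `N`, all other blocks vanish. -/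
def unroll [Mul R] [Zero R] [One R] (L : ℕ) {m : ℕ} (N : Matrix (Fin m) (Fin m) R) : Matrix (Fin (L * m)) (Fin (L * m)) R :=
  Matrix.reindex finProdFinEquiv finProdFinEquiv (shiftMat L R ⊗ₖ N)

theorem unroll_apply [NonAssocSemiring R] (L : ℕ) {m : ℕ} (N : Matrix (Fin m) (Fin m) R) (l l' : Fin L) (i j : Fin m) :
    unroll L N (finProdFinEquiv (l, i)) (finProdFinEquiv (l', j)) = if l'.val = l.val + 1 then N i j else 0 := by
  simp [unroll, shiftMat, ite_mul]

/-- Entrywise maps fixing `0` commute with unrolling. -/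
theorem unroll_map [NonAssocSemiring R] {R' : Type*} [NonAssocSemiring R'] (f : R → R') (hf : f 0 = 0) (L : ℕ) {m : ℕ}
    (N : Matrix (Fin m) (Fin m) R) : (unroll L N).map f = unroll L (N.map f) := by
  ext I J
  obtain ⟨⟨l, i⟩, rfl⟩ := finProdFinEquiv.surjective I
  obtain ⟨⟨l', j⟩, rfl⟩ := finProdFinEquiv.surjective J
  rw [Matrix.map_apply, unroll_apply, unroll_apply]
  split_ifs with h
  · rw [Matrix.map_apply]
  · exact hf

theorem unroll_sub [NonAssocRing R] (L : ℕ) {m : ℕ} (N N' : Matrix (Fin m) (Fin m) R) :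
    unroll L N - unroll L N' = unroll L (N - N') := by
  ext I J
  obtain ⟨⟨l, i⟩, rfl⟩ := finProdFinEquiv.surjective I
  obtain ⟨⟨l', j⟩, rfl⟩ := finProdFinEquiv.surjective J
  rw [Matrix.sub_apply, unroll_apply, unroll_apply, unroll_apply, Matrix.sub_apply]
  split_ifs <;> simp

/-- **POWERS OF THE UNROLLED MATRIX**: the block `(l, l+b)` of `(S_L ⊗ N)^b` is `N^b`, all other blocks vanish. [this file] -/
theorem unroll_pow_apply [Semiring R] (L : ℕ) {m : ℕ} (N : Matrix (Fin m) (Fin m) R) :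
    ∀ (b : ℕ) (l l' : Fin L) (i j : Fin m),
      ((unroll L N) ^ b) (finProdFinEquiv (l, i)) (finProdFinEquiv (l', j)) = if l'.val = l.val + b then (N ^ b) i j else 0
  | 0, l, l', i, j => by
      rw [pow_zero, pow_zero, Matrix.one_apply, Matrix.one_apply, add_zero]
      by_cases hl : l = l'
      · subst hl
        by_cases hij : i = j
        · subst hij; simp
        · have h2 : finProdFinEquiv (l, i) ≠ finProdFinEquiv (l, j) := fun h =>
            hij (Prod.mk.inj (finProdFinEquiv.injective h)).2
          rw [if_neg h2, if_pos rfl, if_neg hij]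
      · have h1 : ¬ (l'.val = l.val) := fun h => hl (Fin.ext h.symm)
        have h2 : finProdFinEquiv (l, i) ≠ finProdFinEquiv (l', j) := fun h =>
          hl (Prod.mk.inj (finProdFinEquiv.injective h)).1
        rw [if_neg h2, if_neg h1]
  | b + 1, l, l', i, j => by
      rw [pow_succ, Matrix.mul_apply, pow_succ, Matrix.mul_apply, ← finProdFinEquiv.sum_comp, Fintype.sum_prod_type]
      simp_rw [unroll_pow_apply L N b, unroll_apply]
      by_cases h : l.val + b < L
      · rw [Finset.sum_eq_single ⟨l.val + b, h⟩]
        · by_cases h' : l'.val = l.val + (b + 1)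
          · rw [if_pos h']
            apply Finset.sum_congr rfl
            intro t _
            rw [if_pos rfl, if_pos (by simpa [Nat.add_assoc] using h')]
          · rw [if_neg h']
            apply Finset.sum_eq_zero
            intro t _
            rw [if_pos rfl, if_neg (by simpa [Nat.add_assoc] using h'), mul_zero]
        · intro k _ hk
          have hk' : ¬ (k.val = l.val + b) := fun hh => hk (Fin.ext hh)
          apply Finset.sum_eq_zero
          intro t _
          rw [if_neg hk', zero_mul]
        · intro habs
          exact absurd (Finset.mem_univ _) habs
      · have hR : ¬ (l'.val = l.val + (b + 1)) := by have := l'.isLt; omega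
        rw [if_neg hR]
        apply Finset.sum_eq_zero
        intro k _
        have hk' : ¬ (k.val = l.val + b) := by have := k.isLt; omega
        apply Finset.sum_eq_zero
        intro t _
        rw [if_neg hk', zero_mul]

variable {L : ℕ}

/-- Unrolling an affine pencil gives an affine pencil. -/
theorem isAffine_unroll (L : ℕ) (N : AffMat n m) (hN : IsAffine N) : IsAffine (n := n) (unroll L N) := by
  intro I J
  obtain ⟨⟨l, i⟩, rfl⟩ := finProdFinEquiv.surjective I
  obtain ⟨⟨l', j⟩, rfl⟩ := finProdFinEquiv.surjective J
  rw [unroll_apply]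
  split_ifs
  · exact hN i j
  · simp

/-- ★ **LEDGER TRANSPORT UNDER UNROLLING** (`0 < L`, `n ≤ L`): the whole-pencil ledgers of `S_L ⊗ N` and of `N` coincide (same `K`, same `k`) —
the `(l, l+b)` block of the `b`-th power is the `b`-th power, and every `b ≤ n − 1` fits. [this file] -/
theorem ledger_unroll_iff (hL0 : 0 < L) (hL : n ≤ L) (N : AffMat n m) (K : Submodule ℂ (Fin n × Fin n → ℂ)) (k : ℕ) :
    Ledger n (L * m) (unroll L N) (fun _ => True) K k ↔ Ledger n m N (fun _ => True) K k := by
  constructor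
  · intro h x v hv b hb i j _ _
    have hbL : b < L := by omega
    have h1 := h x v hv b hb (finProdFinEquiv (⟨0, hL0⟩, i)) (finProdFinEquiv (⟨b, hbL⟩, j)) trivial trivial
    rw [unroll_map _ (map_zero _), unroll_pow_apply, if_pos (by simp)] at h1
    exact h1
  · intro h x v hv b hb I J _ _
    obtain ⟨⟨l, i⟩, rfl⟩ := finProdFinEquiv.surjective I
    obtain ⟨⟨l', j⟩, rfl⟩ := finProdFinEquiv.surjective J
    rw [unroll_map _ (map_zero _), unroll_pow_apply]
    split_ifs
    · exact h x v hv b hb i j trivial trivial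
    · simp

/-- ★ **PRICES ARE PRESERVED**: `RelCert n (L·m) (S_L ⊗ N) P ↔ RelCert n m N P`. [this file] -/
theorem relCert_unroll_iff (hL0 : 0 < L) (hL : n ≤ L) (N : AffMat n m) (P : ℕ) :
    RelCert n (L * m) (unroll L N) P ↔ RelCert n m N P := by
  unfold RelCert
  simp only [ledger_unroll_iff hL0 hL]

/-- **SUPPORT WINDOWS ARE PRESERVED** (via ✓ `MonomialLedger.ledger_coordSpan_iff_suppWindow`). [this file] -/
theorem suppWindow_unroll_iff (hL0 : 0 < L) (hL : n ≤ L) (N₀ : AffMat n m) (T : Finset (Fin n × Fin n)) (k : ℕ) :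
    SuppWindow (n := n) (unroll L N₀) T k ↔ SuppWindow N₀ T k := by
  rw [← Summit.ValiantsHypothesis.ValiantsHypothesis.Theorems.GrenetZeon.MonomialLedger.ledger_coordSpan_iff_suppWindow,
    ← Summit.ValiantsHypothesis.ValiantsHypothesis.Theorems.GrenetZeon.MonomialLedger.ledger_coordSpan_iff_suppWindow,
    ledger_unroll_iff hL0 hL]

end Unroll

/-! ## §3  ℤ-CHAMBERS: the ghost degeneration with INTEGER weights (pivots at positions of either sign, as in `comp-g7/echelon_lift.py`),
and ★ FL3 for them from FL3ᵃ by unrolling -/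

/-- **GHOST DEGENERATION, ℤ-chamber**: as `GhostDegeneration`, with integer coordinate weights. -/
def GhostDegenerationZ (N N₀ : AffMat n m) (a : Fin m → ℤ) (w : Fin n × Fin n → ℤ) : Prop :=
  (∀ i j, MvPolynomial.constantCoeff (N i j) = 0 ∧ MvPolynomial.constantCoeff (N₀ i j) = 0) ∧
  (∀ i j, ∀ d ∈ (N₀ i j).support, ∀ c ∈ d.support, w c = a j - a i) ∧
  (∀ i j, ∀ d ∈ ((N - N₀) i j).support, ∀ c ∈ d.support, w c < a j - a i)

/-- Gap-positivity for integer weights. -/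
def GapPositiveZ (w : Fin n × Fin n → ℤ) (T : Finset (Fin n × Fin n))
    (C : (Fin n × Fin n) → (Fin n × Fin n) → ℂ) : Prop :=
  ∀ e e', C e e' ≠ 0 → e ∈ T ∧ e' ∉ T ∧ w e < w e'

/-- **(FL3ᶻ) ★ LIFTABLE-WINDOW FORMULA along ℤ-chamber ghost degenerations** (the scope the census's irreducible species need). -/
def LiftableWindowFormulaZ : Prop :=
  ∀ (n m : ℕ) (N N₀ : AffMat n m) (a : Fin m → ℤ) (w : Fin n × Fin n → ℤ), Function.Injective w → IsAffine N →
    GhostDegenerationZ N N₀ a w → ∀ P : ℕ,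
    (RelCert n m N P ↔
      ∃ (k : ℕ) (T : Finset (Fin n × Fin n)) (C : (Fin n × Fin n) → (Fin n × Fin n) → ℂ),
        GapPositiveZ w T C ∧ SuppWindow N₀ T k ∧ Ledger n m N (fun _ => True) (liftSpan T C) k ∧ n * k + (n * n - T.card) ≤ P)

/-- Shifting integer weights by `A` with `0 < w c + A` and truncating to `ℕ` preserves gap-positivity. -/
theorem gapPositive_shift_iff (w : Fin n × Fin n → ℤ) (A : ℤ) (hA : ∀ c, 0 < w c + A) (T : Finset (Fin n × Fin n))
    (C : (Fin n × Fin n) → (Fin n × Fin n) → ℂ) :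
    GapPositive (fun c => (w c + A).toNat) T C ↔ GapPositiveZ w T C := by
  unfold GapPositive GapPositiveZ
  refine forall_congr' fun e => forall_congr' fun e' => forall_congr' fun _ => ?_
  have h : (w e + A).toNat < (w e' + A).toNat ↔ w e < w e' := by
    rw [Int.toNat_lt_toNat (hA e')]
    omega
  rw [h]

/-- The ℕ-chamber of the unrolled pencil built from a ℤ-chamber `(a, w)` of `N` and a shift `A`. -/
def unrollWeight (w : Fin n × Fin n → ℤ) (A : ℤ) (c : Fin n × Fin n) : ℕ := (w c + A).toNat

/-- The cocharacter `(l, i) ↦ l·A + a i` on the unrolled coordinates. -/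
def unrollCochar (L : ℕ) (a : Fin m → ℤ) (A : ℤ) (I : Fin (L * m)) : ℤ :=
  ((finProdFinEquiv.symm I).1.val : ℤ) * A + a (finProdFinEquiv.symm I).2

theorem unrollCochar_apply (L : ℕ) (a : Fin m → ℤ) (A : ℤ) (l : Fin L) (i : Fin m) :
    unrollCochar L a A (finProdFinEquiv (l, i)) = (l.val : ℤ) * A + a i := by
  simp [unrollCochar]

/-- ★ **A ℤ-CHAMBER OF `N` IS AN ℕ-CHAMBER OF THE UNROLLED PENCIL.** [this file] -/
theorem ghostDegeneration_unroll (L : ℕ) (N N₀ : AffMat n m) (a : Fin m → ℤ) (w : Fin n × Fin n → ℤ) (A : ℤ)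
    (hA : ∀ c, 0 < w c + A) (hG : GhostDegenerationZ N N₀ a w) :
    GhostDegeneration (n := n) (unroll L N) (unroll L N₀) (unrollCochar L a A) (unrollWeight w A) := by
  obtain ⟨h0, hmatch, hghost⟩ := hG
  have hwA : ∀ c, ((unrollWeight w A c : ℕ) : ℤ) = w c + A := fun c => by
    unfold unrollWeight
    rw [Int.toNat_of_nonneg (le_of_lt (hA c))]
  refine ⟨fun I J => ?_, fun I J => ?_, fun I J => ?_⟩
  · obtain ⟨⟨l, i⟩, rfl⟩ := finProdFinEquiv.surjective I
    obtain ⟨⟨l', j⟩, rfl⟩ := finProdFinEquiv.surjective J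
    rw [unroll_apply, unroll_apply]
    constructor <;> (split_ifs <;> first | exact (h0 i j).1 | exact (h0 i j).2 | exact map_zero _)
  · obtain ⟨⟨l, i⟩, rfl⟩ := finProdFinEquiv.surjective I
    obtain ⟨⟨l', j⟩, rfl⟩ := finProdFinEquiv.surjective J
    intro d hd c hc
    rw [unroll_apply] at hd
    split_ifs at hd with hl
    · rw [hwA, unrollCochar_apply, unrollCochar_apply, hmatch i j d hd c hc]
      have : (l'.val : ℤ) = (l.val : ℤ) + 1 := by exact_mod_cast hl
      rw [this]
      ring
    · simp at hd
  · obtain ⟨⟨l, i⟩, rfl⟩ := finProdFinEquiv.surjective I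
    obtain ⟨⟨l', j⟩, rfl⟩ := finProdFinEquiv.surjective J
    intro d hd c hc
    rw [unroll_sub, unroll_apply] at hd
    split_ifs at hd with hl
    · rw [hwA, unrollCochar_apply, unrollCochar_apply]
      have h1 := hghost i j d hd c hc
      have : (l'.val : ℤ) = (l.val : ℤ) + 1 := by exact_mod_cast hl
      rw [this]
      nlinarith
    · simp at hd

/-- ★★ **FL3ᶻ FROM FL3ᵃ BY UNROLLING.**  With rev 4's kernel theorem `EchelonLift.liftableWindowFormulaAff` (whose statement is the twin
`LiftableWindowFormulaAff` above) this makes the exact price formula available along EVERY ℤ-chamber ghost degeneration of a homogeneous affine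
pencil — in particular on the census's irreducible species, where §1 shows ℕ-chambers are trivial. [this file] -/
theorem liftableWindowFormulaZ_of_aff (hFL3 : LiftableWindowFormulaAff) : LiftableWindowFormulaZ := by
  intro n m N N₀ a w hw hN hG P
  classical
  -- the shift making all weights positive, and the unrolling length
  set A : ℤ := 1 + ∑ c, |w c| with hAdef
  have hA : ∀ c, 0 < w c + A := fun c => by
    have h1 : |w c| ≤ ∑ c', |w c'| :=
      Finset.single_le_sum (f := fun c' => |w c'|) (fun c' _ => abs_nonneg (w c')) (Finset.mem_univ c)
    have h2 := neg_abs_le (w c)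
    omega
  have hL0 : 0 < n + 1 := Nat.succ_pos n
  have hL : n ≤ n + 1 := Nat.le_succ n
  have hwt : Function.Injective (unrollWeight w A) := by
    intro c c' h
    unfold unrollWeight at h
    have h' : ((w c + A).toNat : ℤ) = ((w c' + A).toNat : ℤ) := by exact_mod_cast h
    rw [Int.toNat_of_nonneg (le_of_lt (hA c)), Int.toNat_of_nonneg (le_of_lt (hA c'))] at h'
    exact hw (by omega)
  have key := hFL3 n ((n + 1) * m) (unroll (n + 1) N) (unroll (n + 1) N₀) (unrollCochar (n + 1) a A) (unrollWeight w A)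
    hwt (isAffine_unroll (n + 1) N hN) (ghostDegeneration_unroll (n + 1) N N₀ a w A hA hG) P
  rw [relCert_unroll_iff hL0 hL] at key
  rw [key]
  constructor
  · rintro ⟨k, T, C, h1, h2, h3, h4⟩
    exact ⟨k, T, C, (gapPositive_shift_iff w A hA T C).mp h1, (suppWindow_unroll_iff hL0 hL N₀ T k).mp h2,
      (ledger_unroll_iff hL0 hL N _ k).mp h3, h4⟩
  · rintro ⟨k, T, C, h1, h2, h3, h4⟩
    exact ⟨k, T, C, (gapPositive_shift_iff w A hA T C).mpr h1, (suppWindow_unroll_iff hL0 hL N₀ T k).mpr h2,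
      (ledger_unroll_iff hL0 hL N _ k).mpr h3, h4⟩

end Summit.ValiantsHypothesis.ValiantsHypothesis.Cruxes.DualUnipotentThreeHalves.EchelonLiftScope
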